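import Mathlib
import HarnessLib
import Summits.Ventures.LatticeQCDFlow.Scaling.TorusAcceptanceSandwich2D
import Summits.Ventures.LatticeQCDFlow.Scaling.TorusEssLossSandwich2D
import Summits.Ventures.LatticeQCDFlow.Scaling.TiltPiReindexCentring

/-!
# LatticeQCDFlow / Scaling — TRANSFER OF LIMITS TO THE TORUS: along ANY couplings `β_L → 0`, every limit
# of the factorised `(L² − 1)`-plaquette sampler's acceptance, ESS and reverse loss is the limit of the
# untrained sampler's acceptance, ESS and reverse loss on the periodic `L × L` torus (every compact `G`)

HONEST FRAMING: exact (Metropolis-corrected) sampling algorithms for lattice gauge theory;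
figures of merit are autocorrelation/cost numbers at stated couplings and volumes; no
continuum-physics claim.

Venture `LatticeQCDFlow` (cell pub-lqcd), topic `Scaling`; FANOUT row 3 (`s0-u1-a`, S0-B
implementation A, GEN-21).  NEW WORK of the cell, no numerics, NO definition.  The sandwiches of
`Scaling/TorusAcceptanceSandwich2D` (`e^{±4|β|N}`), `Scaling/TorusEssLossSandwich2D` (`e^{±8|β|N}`,
`±4|β|N`) are uniform in the volume, so for every coupling sequence `β_k → 0` (volume `L = k + 2`,
punctured volume `n_k = (k + 2)² − 1`) the factorised and the torus figures of merit have the same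
limits.  This is the form in which every present and future large-volume law of row 3's factorised
programme (the coupling window `β√n → 0, c, ∞` of `Scaling/IdentityFlowCouplingWindow`, the laws along
general sequences `β_n√n → c` of the staged `Scaling/AcceptanceAlongCouplingSequences`, the heterogeneous
and loss-driven laws) becomes a torus law by one application:

* §1 **`torus_meanAccept_tendsto_of_tiltPi_tendsto`** — `β_k → 0` and
  `acc_F(Fin n_k, Re tr ρ − m, β_k) → a` imply `acc_T(k + 2, β_k) → a` (statistic re-indexed to
  `Fin n_k` and re-centred at the Haar mean `m`, `Scaling/TiltPiReindexCentring`);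
  **`tiltPi_tendsto_of_torus_meanAccept_tendsto`** — and conversely;
* §2 **`torus_essFrac_tendsto_of_factorised_tendsto`** — `(z(β_k)²/z(2β_k))^{n_k} → a ⇒ ESS_T → a`;
* §3 **`torus_reverseKL_tendsto_of_factorised_tendsto`** — `n_k·ℓ(β_k) → a ⇒ D(Haar^{⊗E} ‖ Wilson_{β_k}) → a`
  (`ℓ(β) = log z(β) + β(N − m)`).

NOT CLAIMED: the limits themselves (siblings `Scaling/TorusDiagonalLimit2D`, `TorusDiagonalLimitGroups`;
the `β = c/L` law waits for `Scaling/AcceptanceAlongCouplingSequences`); `d ≥ 3`; any value at the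
cell's `(β, L)`; nothing re-scored, SEALED.md untouched.
-/

noncomputable section

namespace Summit.Ventures.LatticeQCDFlow.Theory2

open MeasureTheory Filter Finset Real Set
open Literature.MathematicalPhysics.QuantumFieldTheory
open scoped Topology

variable {N : ℕ} {G : Type*} [Group G] [TopologicalSpace G] [IsTopologicalGroup G]
  [CompactSpace G] [SecondCountableTopology G] [MeasurableSpace G] [BorelSpace G]
  (ρ : G →* Matrix (Fin N) (Fin N) ℂ)

/-! ## §1 Acceptance -/

section Acceptance

/-- The per-volume link between the torus acceptance and the factorised functional on `Fin ((k+2)² − 1)`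
with the statistic re-centred at `m`: the two-sided `e^{±4|β|N}` sandwich. [ours] -/
theorem torus_meanAccept_sandwich_fin (hρ : Continuous ρ) (k : ℕ) (β m : ℝ) :
    Real.exp (-(4 * |β| * N)) *
        ((∫ z, ∫ z', min (Real.exp (β * ∑ i, ((ρ (z i)).trace.re - m)))
              (Real.exp (β * ∑ i, ((ρ (z' i)).trace.re - m)))
            ∂(Measure.pi fun _ : Fin ((k + 2) ^ 2 - 1) => haarProbability G)
            ∂(Measure.pi fun _ : Fin ((k + 2) ^ 2 - 1) => haarProbability G)) /
          ∫ z, Real.exp (β * ∑ i, ((ρ (z i)).trace.re - m))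
            ∂(Measure.pi fun _ : Fin ((k + 2) ^ 2 - 1) => haarProbability G)) ≤
      ∫ U, ∫ U', min
          (Real.exp (-β * wilsonAction ρ U) /
            ∫ V, Real.exp (-β * wilsonAction ρ V) ∂(Measure.pi fun _ : Edge 2 (k + 2) => haarProbability G))
          (Real.exp (-β * wilsonAction ρ U') /
            ∫ V, Real.exp (-β * wilsonAction ρ V) ∂(Measure.pi fun _ : Edge 2 (k + 2) => haarProbability G))
        ∂(Measure.pi fun _ : Edge 2 (k + 2) => haarProbability G)
        ∂(Measure.pi fun _ : Edge 2 (k + 2) => haarProbability G) ∧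
    ∫ U, ∫ U', min
          (Real.exp (-β * wilsonAction ρ U) /
            ∫ V, Real.exp (-β * wilsonAction ρ V) ∂(Measure.pi fun _ : Edge 2 (k + 2) => haarProbability G))
          (Real.exp (-β * wilsonAction ρ U') /
            ∫ V, Real.exp (-β * wilsonAction ρ V) ∂(Measure.pi fun _ : Edge 2 (k + 2) => haarProbability G))
        ∂(Measure.pi fun _ : Edge 2 (k + 2) => haarProbability G)
        ∂(Measure.pi fun _ : Edge 2 (k + 2) => haarProbability G) ≤
      Real.exp (4 * |β| * N) *
        ((∫ z, ∫ z', min (Real.exp (β * ∑ i, ((ρ (z i)).trace.re - m)))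
              (Real.exp (β * ∑ i, ((ρ (z' i)).trace.re - m)))
            ∂(Measure.pi fun _ : Fin ((k + 2) ^ 2 - 1) => haarProbability G)
            ∂(Measure.pi fun _ : Fin ((k + 2) ^ 2 - 1) => haarProbability G)) /
          ∫ z, Real.exp (β * ∑ i, ((ρ (z i)).trace.re - m))
            ∂(Measure.pi fun _ : Fin ((k + 2) ^ 2 - 1) => haarProbability G)) := by
  have hL : 2 ≤ k + 2 := by omega
  have e : {x : Site 2 (k + 2) // x ≠ 0} ≃ Fin ((k + 2) ^ 2 - 1) :=
    Fintype.equivFinOfCardEq (card_site_ne 0)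
  have hk : (∫ z, ∫ z', min (Real.exp (β * ∑ i, ((ρ (z i)).trace.re - m)))
            (Real.exp (β * ∑ i, ((ρ (z' i)).trace.re - m)))
          ∂(Measure.pi fun _ : Fin ((k + 2) ^ 2 - 1) => haarProbability G)
          ∂(Measure.pi fun _ : Fin ((k + 2) ^ 2 - 1) => haarProbability G)) /
        ∫ z, Real.exp (β * ∑ i, ((ρ (z i)).trace.re - m))
          ∂(Measure.pi fun _ : Fin ((k + 2) ^ 2 - 1) => haarProbability G) =
      (∫ y, ∫ y', min (Real.exp (β * ∑ x, ((ρ (y x)).trace.re - N)))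
            (Real.exp (β * ∑ x, ((ρ (y' x)).trace.re - N)))
          ∂(Measure.pi fun _ : {x : Site 2 (k + 2) // x ≠ 0} => haarProbability G)
          ∂(Measure.pi fun _ : {x : Site 2 (k + 2) // x ≠ 0} => haarProbability G)) /
        ∫ y, Real.exp (β * ∑ x, ((ρ (y x)).trace.re - N))
          ∂(Measure.pi fun _ : {x : Site 2 (k + 2) // x ≠ 0} => haarProbability G) := by
    rw [← tiltPi_ratio_reindex (haarProbability G) e (fun g => (ρ g).trace.re - m)]
    have hsh := tiltPi_ratio_add_const (ι := {x : Site 2 (k + 2) // x ≠ 0}) (haarProbability G)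
      (fun g => (ρ g).trace.re - m) (m - N) β
    simp only [sub_add_sub_cancel] at hsh
    exact hsh.symm
  have h := torus_meanAccept_sandwich ρ hL (0 : Site 2 (k + 2)) hρ β
  rw [← hk] at h
  exact h

/-- **TRANSFER OF LIMITS (acceptance).**  For every compact second-countable `G`, continuous `ρ`,
shift `m` and couplings `β_k → 0`: if the factorised acceptance functional with `(k+2)² − 1` blocks
(statistic `Re tr ρ − m`) tends to `a` along `β_k`, so does the equilibrium acceptance of the untrained
exact sampler on the periodic `(k+2) × (k+2)` torus. [ours] -/
theorem torus_meanAccept_tendsto_of_tiltPi_tendsto (hρ : Continuous ρ) (m : ℝ) {β : ℕ → ℝ}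
    (hβ : Tendsto β atTop (𝓝 0)) {a : ℝ}
    (h : Tendsto (fun k : ℕ =>
        (∫ z, ∫ z', min (Real.exp (β k * ∑ i, ((ρ (z i)).trace.re - m)))
              (Real.exp (β k * ∑ i, ((ρ (z' i)).trace.re - m)))
            ∂(Measure.pi fun _ : Fin ((k + 2) ^ 2 - 1) => haarProbability G)
            ∂(Measure.pi fun _ : Fin ((k + 2) ^ 2 - 1) => haarProbability G)) /
          ∫ z, Real.exp (β k * ∑ i, ((ρ (z i)).trace.re - m))
            ∂(Measure.pi fun _ : Fin ((k + 2) ^ 2 - 1) => haarProbability G)) atTop (𝓝 a)) :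
    Tendsto (fun k : ℕ =>
        ∫ U, ∫ U', min
            (Real.exp (-β k * wilsonAction ρ U) /
              ∫ V, Real.exp (-β k * wilsonAction ρ V) ∂(Measure.pi fun _ : Edge 2 (k + 2) => haarProbability G))
            (Real.exp (-β k * wilsonAction ρ U') /
              ∫ V, Real.exp (-β k * wilsonAction ρ V) ∂(Measure.pi fun _ : Edge 2 (k + 2) => haarProbability G))
          ∂(Measure.pi fun _ : Edge 2 (k + 2) => haarProbability G)
          ∂(Measure.pi fun _ : Edge 2 (k + 2) => haarProbability G)) atTop (𝓝 a) := by
  have hlo := (tendsto_exp_neg_mul_abs_one hβ 4 N).mul h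
  have hhi := (tendsto_exp_mul_abs_one hβ 4 N).mul h
  rw [one_mul] at hlo hhi
  exact tendsto_of_tendsto_of_tendsto_of_le_of_le hlo hhi
    (fun k => (torus_meanAccept_sandwich_fin ρ hρ k (β k) m).1)
    (fun k => (torus_meanAccept_sandwich_fin ρ hρ k (β k) m).2)

/-- **… and conversely**: a limit of the torus acceptance along `β_k → 0` is a limit of the factorised
acceptance functional. [ours] -/
theorem tiltPi_tendsto_of_torus_meanAccept_tendsto (hρ : Continuous ρ) (m : ℝ) {β : ℕ → ℝ}
    (hβ : Tendsto β atTop (𝓝 0)) {a : ℝ}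
    (h : Tendsto (fun k : ℕ =>
        ∫ U, ∫ U', min
            (Real.exp (-β k * wilsonAction ρ U) /
              ∫ V, Real.exp (-β k * wilsonAction ρ V) ∂(Measure.pi fun _ : Edge 2 (k + 2) => haarProbability G))
            (Real.exp (-β k * wilsonAction ρ U') /
              ∫ V, Real.exp (-β k * wilsonAction ρ V) ∂(Measure.pi fun _ : Edge 2 (k + 2) => haarProbability G))
          ∂(Measure.pi fun _ : Edge 2 (k + 2) => haarProbability G)
          ∂(Measure.pi fun _ : Edge 2 (k + 2) => haarProbability G)) atTop (𝓝 a)) :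
    Tendsto (fun k : ℕ =>
        (∫ z, ∫ z', min (Real.exp (β k * ∑ i, ((ρ (z i)).trace.re - m)))
              (Real.exp (β k * ∑ i, ((ρ (z' i)).trace.re - m)))
            ∂(Measure.pi fun _ : Fin ((k + 2) ^ 2 - 1) => haarProbability G)
            ∂(Measure.pi fun _ : Fin ((k + 2) ^ 2 - 1) => haarProbability G)) /
          ∫ z, Real.exp (β k * ∑ i, ((ρ (z i)).trace.re - m))
            ∂(Measure.pi fun _ : Fin ((k + 2) ^ 2 - 1) => haarProbability G)) atTop (𝓝 a) := by
  -- invert the sandwich: `e^{−4δ}·T ≤ F ≤ e^{4δ}·T`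
  have hlo := (tendsto_exp_neg_mul_abs_one hβ 4 N).mul h
  have hhi := (tendsto_exp_mul_abs_one hβ 4 N).mul h
  rw [one_mul] at hlo hhi
  refine tendsto_of_tendsto_of_tendsto_of_le_of_le hlo hhi (fun k => ?_) (fun k => ?_)
  · have h2 := mul_le_mul_of_nonneg_left (torus_meanAccept_sandwich_fin ρ hρ k (β k) m).2
      (Real.exp_pos (-(4 * |β k| * N))).le
    rwa [← mul_assoc, ← Real.exp_add, neg_add_cancel, Real.exp_zero, one_mul] at h2
  · have h1 := mul_le_mul_of_nonneg_left (torus_meanAccept_sandwich_fin ρ hρ k (β k) m).1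
      (Real.exp_pos (4 * |β k| * N)).le
    rwa [← mul_assoc, ← Real.exp_add, add_neg_cancel, Real.exp_zero, one_mul] at h1

end Acceptance

/-! ## §2 Effective sample size -/

section Ess

/-- **TRANSFER OF LIMITS (ESS)**: `β_k → 0` and `(z(β_k)²/z(2β_k))^{(k+2)² − 1} → a` imply that the Kish
fraction `(∫p)²/∫p²` of the untrained sampler on the `(k+2) × (k+2)` torus tends to `a`. [ours] -/
theorem torus_essFrac_tendsto_of_factorised_tendsto (hρ : Continuous ρ) {β : ℕ → ℝ}
    (hβ : Tendsto β atTop (𝓝 0)) {a : ℝ}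
    (h : Tendsto (fun k : ℕ =>
        ((∫ g, Real.exp (β k * ((ρ g).trace.re - N)) ∂(haarProbability G)) ^ 2 /
            ∫ g, Real.exp (2 * β k * ((ρ g).trace.re - N)) ∂(haarProbability G)) ^ ((k + 2) ^ 2 - 1))
        atTop (𝓝 a)) :
    Tendsto (fun k : ℕ =>
        (∫ U, Real.exp (-β k * wilsonAction ρ U) / ∫ V, Real.exp (-β k * wilsonAction ρ V)
              ∂(Measure.pi fun _ : Edge 2 (k + 2) => haarProbability G)
            ∂(Measure.pi fun _ : Edge 2 (k + 2) => haarProbability G)) ^ 2 /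
          ∫ U, (Real.exp (-β k * wilsonAction ρ U) / ∫ V, Real.exp (-β k * wilsonAction ρ V)
              ∂(Measure.pi fun _ : Edge 2 (k + 2) => haarProbability G)) ^ 2
            ∂(Measure.pi fun _ : Edge 2 (k + 2) => haarProbability G)) atTop (𝓝 a) := by
  have hlo := (tendsto_exp_neg_mul_abs_one hβ 8 N).mul h
  have hhi := (tendsto_exp_mul_abs_one hβ 8 N).mul h
  rw [one_mul] at hlo hhi
  exact tendsto_of_tendsto_of_tendsto_of_le_of_le hlo hhi
    (fun k => (torus_essFrac_sandwich ρ (by omega : 2 ≤ k + 2) hρ (β k)).1)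
    (fun k => (torus_essFrac_sandwich ρ (by omega : 2 ≤ k + 2) hρ (β k)).2)

end Ess

/-! ## §3 Reverse loss -/

section Loss

/-- **TRANSFER OF LIMITS (reverse loss)**: `β_k → 0` and `((k+2)² − 1)·(log z(β_k) + β_k(N − m)) → a`
imply `D(Haar^{⊗E} ‖ Wilson_{β_k}) → a` on the `(k+2) × (k+2)` torus. [ours] -/
theorem torus_reverseKL_tendsto_of_factorised_tendsto (hρ : Continuous ρ) {β : ℕ → ℝ}
    (hβ : Tendsto β atTop (𝓝 0)) {a : ℝ}
    (h : Tendsto (fun k : ℕ => ((((k + 2) ^ 2 - 1 : ℕ)) : ℝ) *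
          (Real.log (∫ g, Real.exp (β k * ((ρ g).trace.re - N)) ∂(haarProbability G)) +
            β k * (N - ∫ g, (ρ g).trace.re ∂(haarProbability G)))) atTop (𝓝 a)) :
    Tendsto (fun k : ℕ =>
        ∫ U, Real.log (1 / (Real.exp (-β k * wilsonAction ρ U) /
            ∫ V, Real.exp (-β k * wilsonAction ρ V) ∂(Measure.pi fun _ : Edge 2 (k + 2) => haarProbability G)))
          ∂(Measure.pi fun _ : Edge 2 (k + 2) => haarProbability G)) atTop (𝓝 a) := by
  have hδ : Tendsto (fun k : ℕ => 4 * |β k| * (N : ℝ)) atTop (𝓝 0) := by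
    have h0 : Tendsto (fun k : ℕ => 4 * |β k| * (N : ℝ)) atTop (𝓝 (4 * |(0 : ℝ)| * N)) :=
      (hβ.abs.const_mul 4).mul_const (N : ℝ)
    rwa [abs_zero, mul_zero, zero_mul] at h0
  have hlo := h.sub hδ
  have hhi := h.add hδ
  rw [sub_zero] at hlo
  rw [add_zero] at hhi
  refine tendsto_of_tendsto_of_tendsto_of_le_of_le hlo hhi (fun k => ?_) (fun k => ?_)
  · have hk := abs_le.1 (torus_reverseKL_sandwich ρ (by omega : 2 ≤ k + 2) hρ (β k))
    simp only
    linarith [hk.1]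
  · have hk := abs_le.1 (torus_reverseKL_sandwich ρ (by omega : 2 ≤ k + 2) hρ (β k))
    simp only
    linarith [hk.2]

end Loss

end Summit.Ventures.LatticeQCDFlow.Theory2

end
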